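import Summits.CriticalPhenomena.Ising3DConformalLimit.Theses.ModularBoosts
import Summits.CriticalPhenomena.Ising3DConformalLimit.Theorems.ModularBoostsLimitRotationInvarianceAxis
import HarnessLib

/-!
# Crux `ModularBoosts.ModularBoostIsotropy` (item stmt-CriticalPhenomena-5431) — birth skeleton (BC3),
# line `wedge-boost-speed-one`

Route `route-CriticalPhenomena-ModularBoosts`, crux (M) rank 3:
`Summit.CriticalPhenomena.Ising3DConformalLimit.Theses.ModularBoosts.ModularBoostIsotropy` — for every normalised,
non-degenerate, translation-invariant, scale-covariant pointwise scaling limit `S` of `criticalCorr 3` and every speed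
`v > 0` at which (a) causal slit-gluing and (b) the spectral cone hold, there is `c > 0` with `S n (A ∘ x) = S n x` for
all `n` and every linear `A` preserving `Q_c = x₀² + x₁² + c² x₂²`.

## The line (two named stubs + a kernel-checked composition)

* `stub_wedgeModularBoost` (M1, the modular engine, XL — OPEN).  THE EUCLIDEAN SHADOW OF THE `W₀`-WEDGE BOOSTS: under the
  crux hypotheses, `S n` is invariant (all `n`, all configurations) under the one-parameter group of speed-`v` elliptic
  rotations of the `(x₀, x₂)`-plane about the lattice axis `e₁`,
  `x₀' = cos θ x₀ − v sin θ x₂`, `x₁' = x₁`, `x₂' = v⁻¹ sin θ x₀ + cos θ x₂` (these preserve `x₀² + v² x₂²`).  Intended proof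
  (route header): OS-reconstruct along `e₂`; (b) at `j = 0` is exactly Borchers' hypothesis (positive light-like
  generators `H ± v P₀ ≥ 0` for the wedge `W₀ = {x₀ > v|t|}`), so `Δ_{W₀}^{it}` acts on the translations as speed-`v`
  boosts (Borchers 1992, Thm II.9); WITH an Ising-specific source of wedge duality / modular covariance of `σ`
  (the Bisognano–Wichmann property without Lorentz input — the open core; Yngvason 1994 and Gaier–Yngvason 2000 show it
  is not automatic) the boosts act geometrically on the field (Brunetti–Guido–Longo 1995, Thm 2.3), the Wightman functions
  of `σ` are boost invariant, and their Euclidean points give invariance of `S n` under the imaginary-rapidity boosts =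
  the elliptic rotations above (`boostC i (iφ) = planeRot i φ`, tree `OSLorentzInvariance`).  Only the wedge `W₀` is
  used; the second lattice wedge and the purely spatial rotations are NOT needed (see the composition).
* `stub_boostSpeedOne` (M2, the speed lemma, M — provable now, model-blind linear algebra).  If a family with positive
  two-point function and scale covariance of exponent `Δ > 0` is invariant at level `2` under the axis swap `x₀ ↔ x₂`
  and under the speed-`c` elliptic rotations about `e₁`, then `c = 1`: the quarter turn `A_c` (`θ = π/2`; tree
  `exists_quarterTurnConj`) and the swap `P` give the word `A_c P A_c P = diag(c², 1, c⁻²)` (tree `word_single_zero`),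
  so `S₂(0, c² e₀) = S₂(0, e₀) = (c²)^{-2Δ} S₂(0, e₀) > 0` forces `c = 1` (cf. the proved support item `EllipsoidToSphere`,
  `rotationInvariant_of_ellipsoid_swap`, which assumes the FULL `O(Q_c)`).
* `modularBoostIsotropy_of_stubs` (sorry-free): M1 → M2 → the crux statement, and `ModularBoostIsotropy_of` — the crux
  BY NAME from the two stubs.  The composition is real mathematics, all from landed tree theorems: `Δ > 0` from the
  window `1/2 ≤ Δ ≤ 1` (`HyperoctahedralRPTwoPoint.window`); the swaps `x₀ ↔ x₂`, `x₁ ↔ x₂` pass to every normalised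
  limit (`ModularBoostsRotation.limit_axisPerm`); M2 pins `v = 1`; conjugating the (now round) rotations about `e₁` by
  the swap `x₁ ↔ x₂` gives invariance under the rotations `planeRot 0 θ` about `e₂` at every configuration, whence full
  `O(3)` invariance at each level (`ModularBoostsRotation.rotInvAt_of_rot` = landed `stub_fourfoldToFull` of the sibling
  crux `HyperoctahedralRP.LimitRotationInvariant`: density of axis-generic configurations, continuity off the diagonals,
  `O_h` conjugation, Cartan–Dieudonné); a linear `A` preserving `Q_1 = ‖·‖²` is a linear isometry, hence (finite
  dimension) a `LinearIsometryEquiv`; the crux follows with `c = 1`.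

So the line predicts `c = v = 1` (the route's NUMBERS paragraph) and reduces (M) to ONE operator-algebraic statement
about ONE lattice wedge.  Honest caveat carried from the route: M1 is as hard as the crux given M2 and the tree; what the
skeleton buys is the exact Euclidean target the modular engine must hit (one axis, one one-parameter group, speed `v`)
and the separation of the speed identification (M2) from the engine.

## Disproof used

None exists: `ledger crux ls stmt-CriticalPhenomena-5431` lists no workfiles (no `Disproof.lean`, no `_false_without_`
theorems, no landed `Theorems/ModularBoostIsotropy/Negative/*`) as of 2026-08-17; the summit's negatives index has no
statement about ellipsoidal / boost isotropy.  M1 keeps EVERY crux hypothesis (in particular the scaling-limit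
hypothesis and normalisation, which the sibling crux's disproof file showed load-bearing for rotation statements:
`cruxBody_false_without_scalingLimit`, `cruxBody_false_without_normalisation` of stmt-1980), so no model-blind
generalized-free-field witness (Gaier–Yngvason 2000) is an instance of it.

## BC3 probes (planner-skel-stmt-CriticalPhenomena-5431-0, 2026-08-17; files `bc/probe_stub*.lean` in the seat folder,
importing only `Theses.ModularBoosts` — NOT this file, so `exact?` cannot see the sorried stubs)

Each probe file states `example : (<stub signature>) → <Target> := by <tac>` eight times, under
`set_option maxHeartbeats 400000`, for tac ∈ { `first | exact? | simpa | aesop` (the registrar's literal probe) · `exact?` ·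
`simpa` · `simpa [<Target unfolded>]` · `aesop` · `intro h; exact h` · `intro h; simpa using h` ·
`intro h; simpa [<Target unfolded>] using h` }.  ALL 32 examples FAIL (lean check rc 1, one error per example, 0 sorries):

* `probe_stub1_crux.lean`   (stub_wedgeModularBoost → ModularBoostIsotropy): errors at lines 9 26 33 40 63 (deterministic
  timeout at `whnf`, 400000 heartbeats: no cheap proof inside the certificate budget), 20 (`exact?` could not close the
  goal), 49 (`exact h`: Type mismatch — the stub is not the crux up to defeq), 57 (`simpa using h`: Type mismatch after
  simplification — not the crux up to simp).
* `probe_stub1_summit.lean` (stub_wedgeModularBoost → Ising3DConformalLimit): lines 9 26 33 40 (timeout at `whnf`),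
  20 (`exact?` could not close the goal), 49 (Type mismatch), 57 and 65 (Type mismatch after simplification; the summit
  unfolds to `∃ ρ Δ S, …`, the stub is a `∀`-statement).
* `probe_stub2_crux.lean`   (stub_boostSpeedOne → ModularBoostIsotropy): lines 9 and 40 (unsolved goals — `aesop: failed to
  prove the goal after exhaustive search`), 20 (`exact?` could not close the goal), 27 and 34 (`simpa`: Tactic `assumption`
  failed), 49 (Type mismatch), 57 and 65 (Type mismatch after simplification).
* `probe_stub2_summit.lean` (stub_boostSpeedOne → Ising3DConformalLimit): lines 9 and 40 (unsolved goals after exhaustive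
  aesop search), 20 (`exact?` could not close the goal), 27 and 34 (Tactic `assumption` failed), 49, 57, 65 (Type mismatch).

Verdict bc3: PASS — no stub is cheaply equivalent to the crux or to the summit; `lean check --json` of this file: rc 0,
errors [], sorries 2 = the two `stub_*` (warnings `declaration uses sorry` at the two stub theorems only), and
`modularBoostIsotropy_of_stubs` has axiom closure [propext, Classical.choice, Quot.sound] (no sorryAx).
-/

noncomputable section

open Literature.Probability.LatticeModels
open Literature.MathematicalPhysics.QuantumFieldTheory
open Summit.CriticalPhenomena.Ising3DConformalLimit.Theses.ModularBoosts
open Summit.CriticalPhenomena.Ising3DConformalLimit.ModularBoostsRotation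
open Summit.CriticalPhenomena.Ising3DConformalLimit.MoebiusLimitExistsNegative
open Summit.CriticalPhenomena.Ising3DConformalLimit.Cruxes.LimitRotationInvariant.QuarterTurnLiouville (RotInvAt)

namespace Summit.CriticalPhenomena.Ising3DConformalLimit.Cruxes.ModularBoostIsotropy.WedgeBoostSpeedOne

/-- **Stub M1 `stub_wedgeModularBoost` (the modular engine of route ModularBoosts, one lattice wedge; OPEN, XL).**
Under the hypotheses of the crux `ModularBoostIsotropy` (normalised, non-degenerate, translation-invariant,
scale-covariant pointwise scaling limit `S` of `criticalCorr 3`; speed `v > 0` with (a) causal slit-gluing and (b) the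
spectral cone), `S n` is invariant, for every level `n` and every configuration, under every linear map with the
coordinates of the speed-`v` elliptic rotation by the angle `θ` about `e₁`:
`x₀' = cos θ x₀ − v sin θ x₂`, `x₁' = x₁`, `x₂' = v⁻¹ sin θ x₀ + cos θ x₂` — the Euclidean points of the `W₀`-wedge
boosts of rapidity `iθ` delivered by Borchers' theorem + wedge modular covariance + Brunetti–Guido–Longo.
[cite: Borchers1992, Thm II.9] [cite: BrunettiGuidoLongo1995, Thm 2.3] [cite: GaierYngvason2000, Thm 5.3 (obstruction)] -/
theorem stub_wedgeModularBoost :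
    ∀ (ρ : ℝ → ℝ) (Δ v : ℝ) (S : Literature.Probability.LatticeModels.CorrFamily 3), (∀ δ ∈ Set.Ioc (0:ℝ) 1, 0 < ρ δ) → Literature.Probability.LatticeModels.HasPointwiseScalingLimit (Literature.Probability.LatticeModels.criticalCorr 3) ρ S → (∀ n z, z ∉ Literature.Probability.LatticeModels.NonCoincident 3 n → S n z = 0) → Literature.Probability.LatticeModels.IsNondegenerateTwoPoint S → Literature.Probability.LatticeModels.IsTranslationInvariant S → Literature.Probability.LatticeModels.IsScaleCovariant Δ S → 0 < v → (∀ (n : ℕ) (p q : EuclideanSpace ℝ (Fin 3)) (x : Fin n → EuclideanSpace ℝ (Fin 3)) (R : ℝ), 0 < R → q ≠ 0 → q 2 = 0 → (∀ i, R < |x i 2 - p 2|) → Matrix.vecCons (p + q) (Matrix.vecCons p x) ∈ Literature.Probability.LatticeModels.NonCoincident 3 (n + 1 + 1) → ∃ Φ : ℂ → ℂ, DifferentiableOn ℂ Φ {ζ : ℂ | |ζ.re| < R ∧ (ζ.re ≠ 0 ∨ |ζ.im| < ‖q‖ / v)} ∧ ∀ s : ℝ, |s| < R → Φ (s : ℂ)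 = (S (n + 1 + 1) (Matrix.vecCons (p + q + s • EuclideanSpace.single 2 (1:ℝ)) (Matrix.vecCons p x)) : ℂ)) → (∀ (m k : ℕ) (x : Fin m → EuclideanSpace ℝ (Fin 3)) (y : Fin k → EuclideanSpace ℝ (Fin 3)) (g : ℝ) (j : Fin 3), j ≠ 2 → 0 < g → (∀ a b, x a 2 + g ≤ y b 2) → Fin.append x y ∈ Literature.Probability.LatticeModels.NonCoincident 3 (m + k) → ∃ Φ : ℂ × ℂ → ℂ, DifferentiableOn ℂ Φ {w : ℂ × ℂ | -g < w.1.re ∧ |w.2.im| < v * (w.1.re + g)} ∧ ∀ s b : ℝ, -g < s → Φ ((s : ℂ), (b : ℂ)) = (S (m + k) (Fin.append x (fun i => y i + s • EuclideanSpace.single 2 (1:ℝ) + b • EuclideanSpace.single j (1:ℝ))) : ℂ)) → ∀ (n : ℕ) (θ : ℝ) (A : EuclideanSpace ℝ (Fin 3) →ₗ[ℝ] EuclideanSpace ℝ (Fin 3)), (∀ z : EuclideanSpace ℝ (Fin 3), A z 0 = Real.cos θ * z 0 - v * Real.sin θ * z 2 ∧ A z 1 = z 1 ∧ A z 2 = v⁻¹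 * Real.sin θ * z 0 + Real.cos θ * z 2) → ∀ x : Fin n → EuclideanSpace ℝ (Fin 3), S n (fun i => A (x i)) = S n x := by
  sorry

/-- **Stub M2 `stub_boostSpeedOne` (the speed lemma; provable now, M).** A family `S : CorrFamily 3` with positive
two-point function on non-coincident pairs and scale covariance of exponent `Δ > 0` which, at level `2`, is invariant
under the axis swap `x₀ ↔ x₂` and under the speed-`c` elliptic rotations about `e₁` (`c > 0`, all angles) has `c = 1`:
with the quarter turn `A_c` (`θ = π/2`, tree `ModularBoostsRotation.exists_quarterTurnConj`) and the swap `P`, the word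
`A_c P A_c P` sends `e₀ ↦ c² e₀` and fixes `0` (tree `word_single_zero`), so `S 2 (0, e₀) = S 2 (0, c² e₀) =
(c²)^(-2Δ) S 2 (0, e₀)` with `S 2 (0, e₀) > 0`, i.e. `(c²)^(-2Δ) = 1`. [cite: FrancescoMathieuSenechal1997, §4.3.1] -/
theorem stub_boostSpeedOne :
    ∀ (Δ c : ℝ) (S : Literature.Probability.LatticeModels.CorrFamily 3), 0 < Δ → 0 < c → Literature.Probability.LatticeModels.IsNondegenerateTwoPoint S → Literature.Probability.LatticeModels.IsScaleCovariant Δ S → (∀ x : Fin 2 → EuclideanSpace ℝ (Fin 3), S 2 (fun i => LinearIsometryEquiv.piLpCongrLeft 2 ℝ ℝ (Equiv.swap (0 : Fin 3) 2) (x i)) = S 2 x) → (∀ (θ : ℝ) (A : EuclideanSpace ℝ (Fin 3) →ₗ[ℝ] EuclideanSpace ℝ (Fin 3)), (∀ z : EuclideanSpace ℝ (Fin 3), A z 0 = Real.cos θ * z 0 - c * Real.sin θ * z 2 ∧ A z 1 = z 1 ∧ A z 2 = c⁻¹ * Real.sin θ * z 0 + Real.cos θ * z 2) → ∀ x : Fin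 2 → EuclideanSpace ℝ (Fin 3), S 2 (fun i => A (x i)) = S 2 x) → c = 1 := by
  sorry

/-- **Composition, implication form (sorry-free, kernel-checked):** M1 → M2 → the statement of the crux
`ModularBoostIsotropy` (verbatim), with `c = 1`.  Tree inputs: the window `1/2 ≤ Δ ≤ 1`
(`HyperoctahedralRPTwoPoint.window`), lattice axis swaps pass to normalised limits (`limit_axisPerm`), one-axis rotation
invariance at a level gives `O(3)` at that level (`rotInvAt_of_rot`), and a `Q_1`-preserving linear map is a linear
isometry equivalence (Mathlib `LinearIsometry.toLinearIsometryEquiv`). [folklore] -/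
theorem modularBoostIsotropy_of_stubs
    (h1 : ∀ (ρ : ℝ → ℝ) (Δ v : ℝ) (S : Literature.Probability.LatticeModels.CorrFamily 3), (∀ δ ∈ Set.Ioc (0:ℝ) 1, 0 < ρ δ) → Literature.Probability.LatticeModels.HasPointwiseScalingLimit (Literature.Probability.LatticeModels.criticalCorr 3) ρ S → (∀ n z, z ∉ Literature.Probability.LatticeModels.NonCoincident 3 n → S n z = 0) → Literature.Probability.LatticeModels.IsNondegenerateTwoPoint S → Literature.Probability.LatticeModels.IsTranslationInvariant S → Literature.Probability.LatticeModels.IsScaleCovariant Δ S → 0 < v → (∀ (n : ℕ) (p q : EuclideanSpace ℝ (Fin 3)) (x : Fin n → EuclideanSpace ℝ (Fin 3)) (R : ℝ), 0 < R → q ≠ 0 → q 2 = 0 → (∀ i, R < |x i 2 - p 2|) → Matrix.vecCons (p + q) (Matrix.vecCons p x) ∈ Literature.Probability.LatticeModels.NonCoincident 3 (n + 1 + 1) → ∃ Φ : ℂ → ℂ, DifferentiableOn ℂ Φ {ζ : ℂ | |ζ.re| < R ∧ (ζ.re ≠ 0 ∨ |ζ.im| < ‖q‖ / v)} ∧ ∀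 s : ℝ, |s| < R → Φ (s : ℂ) = (S (n + 1 + 1) (Matrix.vecCons (p + q + s • EuclideanSpace.single 2 (1:ℝ)) (Matrix.vecCons p x)) : ℂ)) → (∀ (m k : ℕ) (x : Fin m → EuclideanSpace ℝ (Fin 3)) (y : Fin k → EuclideanSpace ℝ (Fin 3)) (g : ℝ) (j : Fin 3), j ≠ 2 → 0 < g → (∀ a b, x a 2 + g ≤ y b 2) → Fin.append x y ∈ Literature.Probability.LatticeModels.NonCoincident 3 (m + k) → ∃ Φ : ℂ × ℂ → ℂ, DifferentiableOn ℂ Φ {w : ℂ × ℂ | -g < w.1.re ∧ |w.2.im| < v * (w.1.re + g)} ∧ ∀ s b : ℝ, -g < s → Φ ((s : ℂ), (b : ℂ)) = (S (m + k) (Fin.append x (fun i => y i + s • EuclideanSpace.single 2 (1:ℝ) + b • EuclideanSpace.single j (1:ℝ))) : ℂ)) → ∀ (n : ℕ) (θ : ℝ) (A : EuclideanSpace ℝ (Fin 3) →ₗ[ℝ] EuclideanSpace ℝ (Fin 3)), (∀ z : EuclideanSpace ℝ (Fin 3), A z 0 = Real.cos θ * z 0 - v * Real.sin θ * z 2 ∧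 A z 1 = z 1 ∧ A z 2 = v⁻¹ * Real.sin θ * z 0 + Real.cos θ * z 2) → ∀ x : Fin n → EuclideanSpace ℝ (Fin 3), S n (fun i => A (x i)) = S n x)
    (h2 : ∀ (Δ c : ℝ) (S : Literature.Probability.LatticeModels.CorrFamily 3), 0 < Δ → 0 < c → Literature.Probability.LatticeModels.IsNondegenerateTwoPoint S → Literature.Probability.LatticeModels.IsScaleCovariant Δ S → (∀ x : Fin 2 → EuclideanSpace ℝ (Fin 3), S 2 (fun i => LinearIsometryEquiv.piLpCongrLeft 2 ℝ ℝ (Equiv.swap (0 : Fin 3) 2) (x i)) = S 2 x) → (∀ (θ : ℝ) (A : EuclideanSpace ℝ (Fin 3) →ₗ[ℝ] EuclideanSpace ℝ (Fin 3)), (∀ z : EuclideanSpace ℝ (Fin 3), A z 0 = Real.cos θ * z 0 - c * Real.sin θ * z 2 ∧ A z 1 = z 1 ∧ A z 2 = c⁻¹ * Real.sin θ * z 0 + Real.cos θ * z 2) → ∀ x : Fin 2 → EuclideanSpace ℝ (Fin 3), S 2 (fun i => A (x i)) = S 2 x) → c = 1) :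
    ∀ (ρ : ℝ → ℝ) (Δ v : ℝ) (S : Literature.Probability.LatticeModels.CorrFamily 3), (∀ δ ∈ Set.Ioc (0:ℝ) 1, 0 < ρ δ) → Literature.Probability.LatticeModels.HasPointwiseScalingLimit (Literature.Probability.LatticeModels.criticalCorr 3) ρ S → (∀ n z, z ∉ Literature.Probability.LatticeModels.NonCoincident 3 n → S n z = 0) → Literature.Probability.LatticeModels.IsNondegenerateTwoPoint S → Literature.Probability.LatticeModels.IsTranslationInvariant S → Literature.Probability.LatticeModels.IsScaleCovariant Δ S → 0 < v → (∀ (n : ℕ) (p q : EuclideanSpace ℝ (Fin 3)) (x : Fin n → EuclideanSpace ℝ (Fin 3)) (R : ℝ), 0 < R → q ≠ 0 → q 2 = 0 → (∀ i, R < |x i 2 - p 2|) → Matrix.vecCons (p + q) (Matrix.vecCons p x) ∈ Literature.Probability.LatticeModels.NonCoincident 3 (n + 1 + 1) → ∃ Φ : ℂ → ℂ, DifferentiableOn ℂ Φ {ζ : ℂ | |ζ.re| < R ∧ (ζ.re ≠ 0 ∨ |ζ.im| < ‖q‖ / v)} ∧ ∀ s : ℝ, |s| < R → Φ (s : ℂ)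 = (S (n + 1 + 1) (Matrix.vecCons (p + q + s • EuclideanSpace.single 2 (1:ℝ)) (Matrix.vecCons p x)) : ℂ)) → (∀ (m k : ℕ) (x : Fin m → EuclideanSpace ℝ (Fin 3)) (y : Fin k → EuclideanSpace ℝ (Fin 3)) (g : ℝ) (j : Fin 3), j ≠ 2 → 0 < g → (∀ a b, x a 2 + g ≤ y b 2) → Fin.append x y ∈ Literature.Probability.LatticeModels.NonCoincident 3 (m + k) → ∃ Φ : ℂ × ℂ → ℂ, DifferentiableOn ℂ Φ {w : ℂ × ℂ | -g < w.1.re ∧ |w.2.im| < v * (w.1.re + g)} ∧ ∀ s b : ℝ, -g < s → Φ ((s : ℂ), (b : ℂ)) = (S (m + k) (Fin.append x (fun i => y i + s • EuclideanSpace.single 2 (1:ℝ) + b • EuclideanSpace.single j (1:ℝ))) : ℂ)) → ∃ c : ℝ, 0 < c ∧ ∀ (n : ℕ) (A : EuclideanSpace ℝ (Fin 3) →ₗ[ℝ] EuclideanSpace ℝ (Fin 3)), (∀ z : EuclideanSpace ℝ (Fin 3), (A z) 0 ^ 2 + (A z) 1 ^ 2 + c ^ 2 * (A z) 2 ^ 2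 = z 0 ^ 2 + z 1 ^ 2 + c ^ 2 * z 2 ^ 2) → ∀ x : Fin n → EuclideanSpace ℝ (Fin 3), S n (fun i => A (x i)) = S n x := by
  intro ρ Δ v S hρ hlim hnorm hnd htr hsc hv ha hb
  -- M1: the speed-`v` elliptic rotations about `e₁` (all levels, all configurations)
  have hflow := h1 ρ Δ v S hρ hlim hnorm hnd htr hsc hv ha hb
  -- `Δ > 0` from the tree's window `1/2 ≤ Δ ≤ 1`
  have hΔ : 0 < Δ := by
    have hw := Summit.CriticalPhenomena.Ising3DConformalLimit.HyperoctahedralRPTwoPoint.window hρ hlim hnd hsc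
    linarith [hw.1]
  -- the axis swap `x₀ ↔ x₂` passes to the limit (tree), at level 2
  have hswap02 : ∀ x : Fin 2 → EuclideanSpace ℝ (Fin 3),
      S 2 (fun i => LinearIsometryEquiv.piLpCongrLeft 2 ℝ ℝ (Equiv.swap (0 : Fin 3) 2) (x i)) = S 2 x :=
    fun x => limit_axisPerm hlim hnorm (Equiv.swap (0 : Fin 3) 2) 2 x
  -- M2: the boost speed is the lattice's isotropic speed, `v = 1`
  have hv1 : v = 1 := h2 Δ v S hΔ hv hnd hsc hswap02 (fun θ A hA x => hflow 2 θ A hA x)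
  subst hv1
  refine ⟨1, one_pos, ?_⟩
  intro n A hA x
  -- (i) rotations about the lattice axis `e₂` at level `n`: conjugate the round rotations about `e₁` by `x₁ ↔ x₂`
  set P := LinearIsometryEquiv.piLpCongrLeft 2 ℝ ℝ (Equiv.swap (1 : Fin 3) 2) with hP
  have hPinv : ∀ y : Fin n → EuclideanSpace ℝ (Fin 3), S n (fun i => P (y i)) = S n y :=
    fun y => limit_axisPerm hlim hnorm (Equiv.swap (1 : Fin 3) 2) n y
  have hPP : ∀ z : EuclideanSpace ℝ (Fin 3), P (P z) = z := by
    intro z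
    ext j
    rw [hP, coordPerm_apply, coordPerm_apply]
    simp
  have hrot : ∀ (θ : ℝ) (y : Fin n → EuclideanSpace ℝ (Fin 3)),
      S n (fun i => planeRot (d := 2) 0 θ (y i)) = S n y := by
    intro θ y
    obtain ⟨B, hBdef⟩ : ∃ B : EuclideanSpace ℝ (Fin 3) →ₗ[ℝ] EuclideanSpace ℝ (Fin 3),
        ∀ z, B z = P (planeRot (d := 2) 0 θ (P z)) :=
      ⟨P.toLinearEquiv.toLinearMap ∘ₗ (planeRot (d := 2) 0 θ).toLinearEquiv.toLinearMap ∘ₗ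
          P.toLinearEquiv.toLinearMap, fun z => rfl⟩
    have hB : ∀ z : EuclideanSpace ℝ (Fin 3),
        B z 0 = Real.cos (-θ) * z 0 - 1 * Real.sin (-θ) * z 2 ∧ B z 1 = z 1 ∧
          B z 2 = 1⁻¹ * Real.sin (-θ) * z 0 + Real.cos (-θ) * z 2 := by
      intro z
      refine ⟨?_, ?_, ?_⟩
      · rw [hBdef, hP, coordPerm_apply]
        simp [planeRot_apply, coordPerm_apply, Equiv.swap_apply_def, Real.cos_neg, Real.sin_neg]
        try ring
      · rw [hBdef, hP, coordPerm_apply]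
        simp [planeRot_apply, coordPerm_apply, Equiv.swap_apply_def]
      · rw [hBdef, hP, coordPerm_apply]
        simp [planeRot_apply, coordPerm_apply, Equiv.swap_apply_def, Real.cos_neg, Real.sin_neg]
        try ring
    have key : (fun i => planeRot (d := 2) 0 θ (y i)) = fun i => P (B (P (y i))) := by
      funext i
      rw [hBdef, hPP, hPP]
    have e1 : S n (fun i => P (B (P (y i)))) = S n (fun i => B (P (y i))) := hPinv _
    have e2 : S n (fun i => B (P (y i))) = S n (fun i => P (y i)) := hflow n (-θ) B hB _
    rw [key, e1, e2, hPinv y]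
  have hR : RotInvAt S n := rotInvAt_of_rot hρ hlim hnorm hnd htr hsc n hrot
  -- (ii) `A` preserves `Q_1 = ‖·‖²`: it is a linear isometry, hence a linear isometry equivalence of `ℝ³`
  have hAn : ∀ z : EuclideanSpace ℝ (Fin 3), ‖A z‖ = ‖z‖ := by
    intro z
    have h := hA z
    have h2 : ‖A z‖ ^ 2 = ‖z‖ ^ 2 := by
      rw [EuclideanSpace.norm_sq_eq, EuclideanSpace.norm_sq_eq]
      simp only [Fin.sum_univ_three, Real.norm_eq_abs, sq_abs]
      linarith
    rw [← Real.sqrt_sq (norm_nonneg (A z)), ← Real.sqrt_sq (norm_nonneg z), h2]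
  let Li : EuclideanSpace ℝ (Fin 3) →ₗᵢ[ℝ] EuclideanSpace ℝ (Fin 3) := ⟨A, hAn⟩
  let R : EuclideanSpace ℝ (Fin 3) ≃ₗᵢ[ℝ] EuclideanSpace ℝ (Fin 3) := Li.toLinearIsometryEquiv rfl
  have hRx : S n (fun i => R (x i)) = S n x := hR R x
  have hfun : (fun i => A (x i)) = fun i => R (x i) := rfl
  rw [hfun]
  exact hRx

/-- **`ModularBoostIsotropy_of` — the crux BY NAME from the two stubs** (skeleton theorem audited by
`#h21_check_skeleton`; sorries only inside `stub_wedgeModularBoost`, `stub_boostSpeedOne`). [folklore] -/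
theorem ModularBoostIsotropy_of :
    _root_.Summit.CriticalPhenomena.Ising3DConformalLimit.Theses.ModularBoosts.ModularBoostIsotropy :=
  modularBoostIsotropy_of_stubs stub_wedgeModularBoost stub_boostSpeedOne

end Summit.CriticalPhenomena.Ising3DConformalLimit.Cruxes.ModularBoostIsotropy.WedgeBoostSpeedOne

end
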